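import Summits.BirchSwinnertonDyer.BirchSwinnertonDyer.Theorems.KimAtThreeDeepLowerExpStarOmegaPlace
import Summits.BirchSwinnertonDyer.Rank1Residual.Additive.PadicLogImage
import HarnessLib

/-!
# A class with `exp*_ω ≠ 0` from the displayed `hdual` clause of hKatoV2₀
# (crux `KatoKuriharaPortThreeShared`, stmt-BirchSwinnertonDyer-19560; cell `bsd-addord`, seat w2-acc5 gen 5;
# route W2 `KimAtThreeKolyvagin`; `--supports 19560`, helper)

HONEST FRAMING.  Two TOOL theorems (no definition, no named fact, no `sorry`); general prime `p` and place
`v ∣ p`; closes nothing; nothing is booked; BSD is not proved by any of this.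

WHAT.  The LEAD's (GAL_loc) (`KimAtThreeFineKatoExpStarGalois.expStarOmega_galois`, kim3 g15) and its
instantiation `KimAtThreeFineKatoValueEquivarianceExpStar.zetaBody_C3a_of_cocycleDef_expStar` (w2-acc5) take
ONE class `h₀ ∈ H¹(ℚ_v, T_pW)` with `exp*_d h₀ ≠ 0`.  On the Kato stratum this is free from hKatoV2₀'s own
first displayed clause `hdual` — «`a ∈ exp*_d(H¹)` iff `‖a · log_E Q‖ ≤ 1` for all `Q ∈ E(ℚ_p)`» — because
the `p`-adic logarithm of a `p`-integral elliptic curve is BOUNDED on `E(ℚ_p)`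
(`LocalLog.range_padicLog_eq_span_zpow`: `log(E(ℚ_p)) = p^e ℤ_p`): `a = p^N` with `N ≥ -e` qualifies, and
`exp*_d y = p^N ≠ 0`.

* `exists_norm_padicLog_le` — `∃ e, ∀ Q, ‖log_E Q‖ ≤ p^{-e}`.
* `exists_expStarOmegaAt_ne_zero_of_dual` — `hdual ⟹ ∃ h₀, exp*_d h₀ ≠ 0`.

References: J. H. Silverman, *AEC* (2009) IV.6.4, VII.6.3 [SilvermanAEC2009]; S. Bloch, K. Kato (1990) §3
Prop. 3.8 / Ex. 3.11 [BlochKato1990]; K. Kato, LNM 1553 (1993) Ch. II §1.2.4 [Kato1993LNM1553].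
-/

noncomputable section

-- the cell's Theorems namespace `Summit.BirchSwinnertonDyer.BirchSwinnertonDyer.…` repeats the summit name by design (D-0017)
set_option linter.dupNamespace false

open scoped Classical NumberField
open IsDedekindDomain NumberField
open Literature.NumberTheory.GaloisRepresentations Literature.NumberTheory.PAdicHodge
open Summit.BirchSwinnertonDyer.Rank1Residual.GaloisImage
open Summit.BirchSwinnertonDyer.Rank1Residual.Additive.LocalLog
open Summit.BirchSwinnertonDyer.BirchSwinnertonDyer.Theorems.KimAtThreeDeepLowerExpStarOmega
open Summit.BirchSwinnertonDyer.BirchSwinnertonDyer.Theorems.KimAtThreeDeepLowerExpStarOmegaPlace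

namespace Summit.BirchSwinnertonDyer.BirchSwinnertonDyer.Theorems.KimAtThreeFineKatoExpStarNonzero

variable {p : ℕ} [hp : Fact p.Prime]

/-- **The `p`-adic logarithm of a `p`-integral elliptic curve is bounded on `E(ℚ_p)`**: there is `e ∈ ℤ`
with `‖log_E Q‖ ≤ p^{-e}` for every `Q` (`log(E(ℚ_p)) = p^e ℤ_p`). [cite: SilvermanAEC2009, IV.6.4 and VII.6.3] -/
theorem exists_norm_padicLog_le (X : WeierstrassCurve ℚ_[p]) [X.IsIntegral ℤ_[p]] [X.IsElliptic] :
    ∃ e : ℤ, ∀ Q : X.toAffine.Point, ‖padicLog X Q‖ ≤ (p : ℝ) ^ (-e) := by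
  refine ⟨(2 : ℤ) + padicValNat p (Nat.card (AddCommGroup.torsion X.toAffine.Point)) -
    padicValNat p (X.formalFiltration 2).index, fun Q => ?_⟩
  have hQ : padicLog X Q ∈ (padicLog X).range := ⟨Q, rfl⟩
  rw [range_padicLog_eq_span_zpow, Submodule.mem_toAddSubgroup, Submodule.mem_span_singleton] at hQ
  obtain ⟨t, ht⟩ := hQ
  rw [← ht, ← Padic.norm_p_zpow, Algebra.smul_def, norm_mul]
  exact mul_le_of_le_one_left (norm_nonneg _) (PadicInt.norm_le_one t)

/-- **A class with `exp*_d ≠ 0` from `hdual`.**  If `exp*_d(H¹(ℚ_v, T_pW))` (read in `ℚ_p` through `ι`) is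
`{a : ‖a · log_E Q‖ ≤ 1 ∀ Q}` (hKatoV2₀'s / hKdef₀'s displayed `hdual`, [BK90] Prop. 3.8 + Tate duality), then
some class has `exp*_d ≠ 0`: `a = p^N` with `N` large lies in that set because `log_E` is bounded
(`exists_norm_padicLog_le`). [cite: BlochKato1990, §3 Prop. 3.8 and Ex. 3.11] [cite: Kato1993LNM1553, Ch. II §1.2.4] -/
theorem exists_expStarOmegaAt_ne_zero_of_dual (W : WeierstrassCurve ℚ) [W.IsElliptic]
    [(W.baseChange ℚ_[p]).IsIntegral ℤ_[p]]
    (v : HeightOneSpectrum (𝓞 ℚ)) [Fact (((p : ℕ) : 𝓞 ℚ) ∈ v.asIdeal)] :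
    letI := valuativeRelPlace v
    letI := topologicalSpacePlace v
    haveI := isNonarchimedeanLocalField_place v
    haveI := charZero_place v
    letI := padicAlgebraPlace p v
    haveI := fact_not_isUnit_place p v
    haveI := isAdicComplete_place p v
    ∀ (d : LocalNeronLineAt W p v)
      (hinj : (bdRPeriodRingData (valuation_place_lt_one p v)).CupLogInjective (logCyclotomic p)
        (localRationalTateRep W p (galRestrictPlace v)))
      (hex : ∀ z : contOneCocycles (localRationalTateRep W p (galRestrictPlace v)).toTopRep,
        (bdRPeriodRingData (valuation_place_lt_one p v)).HasDualExp (logCyclotomic p)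
          (localRationalTateRep W p (galRestrictPlace v)) fun σ => z.1 σ)
      (ι : Place.Completion (Sum.inr v : Place ℚ) →+* ℚ_[p]),
      (∀ a : ℚ_[p], (∃ y, expStarOmegaPadicAt d hinj hex ι y = a) ↔
        ∀ Q : (W.baseChange ℚ_[p]).toAffine.Point, ‖a * padicLog (W.baseChange ℚ_[p]) Q‖ ≤ 1) →
      ∃ h₀ : (tateLocalRep W p (Sum.inr v)).cohomology 1, expStarOmegaAt d h₀ ≠ 0 := by
  intro d hinj hex ι hdual
  obtain ⟨e, he⟩ := exists_norm_padicLog_le (W.baseChange ℚ_[p])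
  have hp0 : (p : ℚ_[p]) ≠ 0 := Nat.cast_ne_zero.mpr hp.out.ne_zero
  have hp1 : (1 : ℝ) ≤ p := Nat.one_le_cast.mpr hp.out.one_lt.le
  obtain ⟨y, hy⟩ := (hdual ((p : ℚ_[p]) ^ (-e).toNat)).mpr fun Q => by
    rw [norm_mul, norm_pow, Padic.norm_p, inv_pow, ← zpow_natCast, ← zpow_neg]
    calc (p : ℝ) ^ (-((-e).toNat : ℤ)) * ‖padicLog (W.baseChange ℚ_[p]) Q‖
        ≤ (p : ℝ) ^ (-((-e).toNat : ℤ)) * (p : ℝ) ^ (-e) :=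
          mul_le_mul_of_nonneg_left (he Q) (zpow_nonneg (Nat.cast_nonneg p) _)
      _ = (p : ℝ) ^ (-((-e).toNat : ℤ) + -e) :=
          (zpow_add₀ (Nat.cast_ne_zero.mpr hp.out.ne_zero) _ _).symm
      _ ≤ 1 := zpow_le_one_of_nonpos₀ hp1 (by have := Int.self_le_toNat (-e); omega)
  refine ⟨y, fun h0 => ?_⟩
  have h := expStarOmegaPadicAt_apply d hinj hex ι y
  rw [hy, h0, map_zero] at h
  exact pow_ne_zero _ hp0 h

end Summit.BirchSwinnertonDyer.BirchSwinnertonDyer.Theorems.KimAtThreeFineKatoExpStarNonzero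

end
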